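import Mathlib
import HarnessLib
import HarnessLib.Audit
import Summits.QuantumFields.Statement
import HarnessLib.Audit.Status.Attr

/-!
Route: QuarksAsStableAction

DORMANT since 2026-08-25T06:27:50Z (reconciler: no traction for 7.5 d (last activity statement-checked at 2026-08-17T19:04:04Z); parked, not closed — `ledger route dormant route-QuantumFields-QuarksAsStableAction --off` to reactivate) — unstaffed, not closed; items shared with open routes are served there. `ledger route dormant <id> --off` reactivates.

# Route QuarksAsStableAction — quarks as a stable action — marginal RP gives chessboard large-field
bounds for unquenched Wilson-quark QCD, plus a stability (sharp form diamagnetism) bound on the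
quark determinant

It suffices to show X = A ∧ S ∧ B. A (UnquenchedChessboardBound): for SU(3) lattice QCD with N_f
flavours of r = 1 Wilson quarks,
ANTIPERIODIC in all four directions on EVEN tori, bare masses in any compact window of (−1, ∞) (κ <
1/6), the honest SIGNED Berezin
functional obeys a chessboard large-field bound |⟨∏_{p∈R} 1[3 − Re tr U_p ≥ δ]⟩| ≤ (C e^{−cβ})^{|R|}
for β ≥ β₀, constants independent of
the volume and of R — dynamical quarks cost one constant in large-field suppression. S
(WilsonQuarkStability): pathwise, for bare masses
|m| ≤ ε (κ in a neighbourhood of 1/8, the scaling regime of `IsQCDAlong`) and every gauge field on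
tori of side ≥ L₀,
|det D_AP[U, m]| ≤ e^{K + c₂ S_good(U) + C N_bad(U)} · det D_AP[𝟙, m] (S_good = Wilson action of the
δ-good plaquettes, N_bad = number of
δ-bad ones): the quark effective action is bounded below by a local positive gauge action — "quarks
are a stable action". B
(StableActionBridge): A → S → QCD — a weak-coupling renormalisation group for the quark-improved
action (small-field fermionic integration
in the δ-good regions, chessboard rarity of the bad regions at the bare scale, Yang–Mills infrared
for the resulting pure-gauge-type
measure) produces one mass-independent regularisation with lattice gap and OS continuum limit along
a sequence, for N_f = 2 and 3.
Realises card quarks-as-stable-action: A = its engine (A)/P1; S = the load-bearing form of its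
conjecture (B); the SHARP form (c₁ > 0 in
place of the allowance c₂: |det| strictly decreased by curvature) is the separate rank-2 crux
CriticalLineDiamagnetism, which implies S
(support DiamagnetismImpliesStability) and is the card's distinctive, cheaply refutable bet.
Lean: `UnquenchedChessboardBound ∧ WilsonQuarkStability ∧ StableActionBridge`

## Assembly
Two closing paths, both pure logic. WEAK path = the deciding theorem `closes :
UnquenchedChessboardBound → WilsonQuarkStability →
StableActionBridge → QCD` (D-0027 §2.1, native OK, unchanged): B is by definition the implication A
→ S → QCD, so A, S, B ⊢ QCD by modus
ponens; the conjunct constant is the root-level `QCD := QCDOf 2 ∧ QCDOf 3` of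
`Summits/QuantumFields/QCD/Statement.lean` (there is no
`Summit.QuantumFields.QCD` alias). SHARP path = the Assembly item, restated 2026-08-16 by
route-repair (ground battery: the weak-path
assembly is a propositional tautology, `ground.trivial`, and duplicated `closes` verbatim; the gate
keeps exactly one assembly item):
`CriticalLineDiamagnetism → UnquenchedChessboardBound → StableActionBridge → QCD`, i.e. cruxes #2,
#3, #5 ⊢ QCD, proved by
`hB hA (DiamagnetismImpliesStability hC)` from the landed support
`Theorems.diamagnetismImpliesStability_proof` (c₂ := −c₁; planner's
Sketch.lean `assemblyR_holds`, rc 0, axioms propext/Classical.choice/Quot.sound).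
CriticalLineDiamagnetism enters only through
DiamagnetismImpliesStability and remains NOT load-bearing for `closes`.

Rationale: WHY THIS LINE. Integrate the quarks out exactly and never expand the determinant: two QCD-specific
POSITIVITY structures then do the work that
expansions cannot do near κ_c. (i) Joint Osterwalder–Seiler/Lüscher site-reflection positivity of
(U, ψ, ψ̄) for r = 1, κ < 1/6
(Luscher1977, OsterwalderSeilerAnnPhys1978, MontvayMunster1994 §4.2.3 (4.99)–(4.111)) restricts to
functions of U alone, so the
det-weighted, even sign-indefinite (N_f = 3, split masses) gauge functional is reflection positive —
the Kennedy–Lieb move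
(KennedyLieb1986: integrate itinerant fermions, keep RP, run Peierls/chessboard) transplanted from
the Falicov–Kimball model to lattice
QCD — and Fröhlich–Israel–Lieb–Simon chessboard estimates (FrohlichIsraelLiebSimon1978,
FrohlichIsraelLiebSimon1980; in pure lattice
gauge theory BorgsSeiler1983, KovacsTomboulis1998) give volume- and k-uniform large-field rarity
with the quarks entering through one
constant. (ii) The induced action −log det is, at leading hopping order, a POSITIVE multiple of
Wilson's action (plaquette spin trace
−8; HasenfratzDegrand1994's Δβ > 0) and, for smooth fields, the positive screening logarithm; the
route bets that a global lower
bound (stability, c₂) — and conjecturally strict diamagnetism (c₁ > 0) — survives at κ ≈ 1/8, making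
"unquenched = pure gauge with an
improved positive action" literally true pathwise up to an O(1) price per lattice dislocation.
Imported areas: reflection positivity /
chessboard estimates (rigorous statistical mechanics), determinant inequalities for fermions in
background fields (Lieb1994,
LiebLoss1993, HogreveSchraderSeiler1978, BrydgesFrohlichSeiler1979), constructive RG
(Balaban1989LargeFieldII, BalabanOcarrollSchor1989).
No QCD route existed at drafting (no Theses/ directory); the sibling card
quark-determinant-chessboard uses RP sideways at a fixed background (pathwise Schwarz), this
line uses RP of the MEASURE plus a stability bound — the two are complementary and share no item.

RANKED CRUXES. (#0 Target — the optional restatement X = A ∧ S ∧ B — was dropped at rev 1: the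
deciding theorem `closes` carries A → S → B → QCD directly.)
#2 CriticalLineDiamagnetism (crux) — [card conjecture (B), sharp form] there are ε, δ, c₁ > 0,
constants K, C and L₀ such that for every torus side L ≥ L₀, every bare mass |m| ≤ ε (κ = 1/(2m+8)
near 1/8) and EVERY SU(3) gauge field U, the r = 1 Wilson determinant with antiperiodic quarks
(seam: links leaving the slice x_μ = −1 sign-flipped in U(3)) satisfies |det D_AP[U,m]| ≤ exp(K −
c₁·S_good(U) + C·N_bad(U))·|det D_AP[𝟙,m]|, where S_good = Σ over plaquettes with deficit 3 − Re tr
U_p < δ of the deficit and N_bad = #{p : deficit ≥ δ}: curvature strictly LOWERS |det| (Wilson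
quarks are diamagnetic), up to an O(1) price per dislocation and an O(1) finite-volume constant.
[difficulty: L] (why it might fail: One-loop sign CHECKED positive over the whole zone on 4⁴/6⁴ AP
tori (kit j000841: inf S_f/S_W = +0.0064 at p = (π,π,π,π), m = 0, −0.1); remaining traps:
moderate-amplitude non-abelian fields beyond second order, the L → ∞ / |m| ≤ ε corners, an untested
Wilson analogue of Lieb's flux phase.) [Lieb1994, LiebLoss1993, HogreveSchraderSeiler1978,
HasenfratzDegrand1994, BrydgesFrohlichSeiler1979, kit:j000841, kit:j000738]
#3 UnquenchedChessboardBound (crux) — [card engine (A)/P1] for every N_f, every mass window [m_lo,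
m_hi] with m_lo > −1 and every δ > 0 there are C, c > 0, β₀ such that for all β ≥ β₀, all EVEN L ≥
4, all bare masses m_f in the window and all sets R of plaquettes: |∫_{all p∈R δ-bad} ∏_f det
D_AP[U, m_f] dμ_W,β(U)| / |∫ ∏_f det D_AP[U, m_f] dμ_W,β(U)| ≤ (C e^{−cβ})^{|R|} (μ_W,β = SU(3)
Wilson probability measure; D_AP the antiperiodic r = 1 Wilson–Dirac operator; signed determinants,
any N_f, split masses). Route of proof: marginal site-RP in all four axes (MarginalSiteRP) ⇒ FILS
chessboard ⇒ universal bad pattern bounded by crude two-sided determinant bounds and a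
transfer-matrix lower bound on the signed partition function. [deps: MarginalSiteRP] [difficulty: L]
(why it might fail: As typed it needs joint site-RP (r=1, κ<1/6, ANTIPERIODIC quarks, even L)
restricted to U in all four axes, chessboard bookkeeping for plaquette events shared between cells,
and an e^{−O(L⁴)} lower bound on the SIGNED partition function for odd N_f; any gap forces a weaker
form.) [FrohlichIsraelLiebSimon1978, FrohlichIsraelLiebSimon1980, KennedyLieb1986, Luscher1977,
OsterwalderSeilerAnnPhys1978, MontvayMunster1994, BorgsSeiler1983, KovacsTomboulis1998,
KoteckyShlosman1982]
#4 WilsonQuarkStability (crux) — [load-bearing weak form of (B)] there are ε, δ > 0, constants K,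
c₂, C and L₀ such that for all L ≥ L₀, |m| ≤ ε and all SU(3) gauge fields U: |det D_AP[U,m]| ≤ exp(K
+ c₂·S_good(U) + C·N_bad(U))·|det D_AP[𝟙,m]| — the quark effective action relative to the
antiperiodic free determinant is bounded BELOW by −c₂·(Wilson action of good plaquettes) − C·(number
of bad plaquettes) − K, uniformly in the volume, for bare masses around the critical region κ ≈ 1/8:
quarks are a stable (Wilson-dominated) action. [difficulty: L] (why it might fail: Needs an
O(1)-per-dislocation bound on log|det| although the quark correlation length 1/|m| → ∞ in lattice
units, and holonomy sectors controlled by one constant K; a super-quadratic wrong-sign response (F²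
log(1/F)) to smooth sub-threshold fields at κ≈1/8 refutes it.) [BalabanOcarrollSchor1989,
BrydgesFrohlichSeiler1979, HogreveSchraderSeiler1978, MontvayMunster1994, RobergeWeiss1986]
#5 StableActionBridge (crux) — A → S → QCD: given the chessboard large-field bound for the AP-even
unquenched family and the stability bound on the Wilson-quark determinant, construct for N_f = 2 and
N_f = 3 a mass-independent regularisation with leading-log mass scaling along which honest lattice
QCD has a volume-uniform lattice gap and OS continuum limits with non-trivial glue and dynamical
quarks (`QCDOf 2 ∧ QCDOf 3`): a block renormalisation group treating e^{−βS_W} ∏_f det D as a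
pure-gauge measure with a positive quasi-local improvement (small-field fermionic perturbation
theory with Gram bounds inside δ-good regions, chessboard rarity of bad regions at the bare scale,
Peierls diluteness), followed by the Yang–Mills infrared for that measure and the transfer from
AP-even tori to the statement's periodic odd tori. [deps: UnquenchedChessboardBound,
WilsonQuarkStability] [difficulty: open-problem] (why it might fail: Contains UV stability with
dynamical Wilson quarks in a fluctuating non-abelian field (block fermions exist only for
external/abelian fields), the Yang–Mills infrared, and the AP-even → periodic-odd transfer;
chessboard gives bare-scale probabilities, not conditional densities per scale.)
[Balaban1989LargeFieldII, Balaban1988Convergent, Balaban1987RG1, BalabanOcarrollSchor1989,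
Dimock2022QED3, JaffeWitten2000, Seiler1982]
#9 SmallHoppingDiamagnetism (support) — [first rung of the rank-2 crux; provable now] there are m₀ >
0, c₁ > 0, C such that for every L ≥ 2, every bare mass m ≥ m₀ (κ = 1/(2m+8) ≤ κ₀) and every SU(3)
gauge field U: |det D_AP[U,m]| ≤ exp(C·L⁴·(8κ)^L − c₁ κ⁴ S_W(U))·|det D_AP[𝟙,m]| (full Wilson
action, no bad-plaquette allowance; the slack C L⁴ (8κ)^L pays for loops winding around the torus).
Proof sketch: ‖κH[U]‖ ≤ 8κ < 1 for every U, so log det(1 − κH) = −Σ κⁿ Tr Hⁿ/n converges; closed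
paths C contribute 2 tr(Γ_C)(Re tr U_C − 3) with tr Γ_C real, the plaquette term has tr Γ = −8
(exact positive κ⁴ coefficient), orders ≥ 6 are bounded by |area|·Σ_{p}(3 − Re tr U_p) and summed
geometrically. [difficulty: provable-now] [MontvayMunster1994, HasenfratzDegrand1994, Rothe2005]
#9 DiamagnetismImpliesStability (support) — CriticalLineDiamagnetism → WilsonQuarkStability (take c₂
= −c₁; pure logic, proved in Sketch.lean `diamagnetismImpliesStability_holds`, rc 0). [difficulty:
provable-now] [KennedyLieb1986]
#9 MarginalSiteRP (support) — [card P1 lemma; provable now] for every N_f, every even L ≥ 4, every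
real β and bare masses m_f > −1 (κ_f < 1/6): the signed unquenched gauge functional F ↦ ∫ F(U) ∏_f
det D_AP[U,m_f] dμ_W,β(U) is reflection positive for the SITE reflection Θ₀U = (τ_{e₀}U).timeReflect
in the lattice hyperplanes t = 0, L/2 (as in `TorusSiteRP`): for bounded measurable F depending only
on links with both endpoints in 0 ≤ t ≤ L/2, ∫ conj(F(Θ₀U))·F(U)·∏det dμ_W has non-negative real
part and zero imaginary part. It is the restriction of Lüscher/Osterwalder–Seiler joint (U, ψ, ψ̄)
site-RP (r = 1, |K| < 1/6, antiperiodic = trace) to Grassmann-free F; the other three axes follow by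
symmetry. [difficulty: provable-now] [Luscher1977, OsterwalderSeilerAnnPhys1978, MontvayMunster1994,
KennedyLieb1986]

DECOMPOSITION OF #5 (crux-strategist cstrat-stmt-QuantumFields-9737-r1, 2026-08-17; EXEMPT-46
re-exam verdict TRIVIAL-SEAM on the earlier ThresholdQCD ∧ (ThresholdQCD → QCDOf) seam). With A (#3)
and S (#4) theorems of the tree, #5 StableActionBridge IS the conjunct QCD
(`stableActionBridge_iff_qcd`, p132266). It is now carried by THREE STATEMENT-SHAPED pieces: #7
ThresholdQCD (8794, threshold regime, shared with HeavyThresholdYMBridge) ∧ #6 MassContinuation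
(18327: the massive phase is OPEN below a uniformly gapped threshold — uniform-in-mass UV/IR
stability of light Wilson quarks + Vitali continuation in the bare mass) ∧ #8 ChiralTupleGapless
(18328: a regularisation realising the body on a half-orthant has a GAPLESS chiral tuple —
Goldstone/anomaly), through the glue StableActionBridgeOfPieces (support 18329) whose proof is NOT
logic: least admissible threshold M⋆ = sInf{M | body above M} (bounded below by the gapless tuple,
admissible by a least-component argument, gap closure above M⋆ forced by MassContinuation) +
re-centring m_crit(k) ↦ m_crit(k) + a_k M⋆/Z_m(k) ⇒ re-typed QCDOf incl. IsChiralAtZero —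
kernel-checked in Cruxes/StableActionBridge/Lines/least_threshold.lean (`StableActionBridge_of`,
≈120 lines, axioms propext/Classical.choice/Quot.sound; Theorems-ready file attached to 18329 for a
prover). ChiralCompletion (17394) is DERIVED (`chiralCompletion_of_pieces`) and re-badged support.
BC2 probes piece → QCD / piece → StableActionBridge failed for all three pieces.

TWO-LAYER PLAN. REALISED for B (2026-08-17): B ⇐ ThresholdQCD → MassContinuation →
ChiralTupleGapless (glue StableActionBridgeOfPieces, proved; see DECOMPOSITION OF #5) — the chain
DiluteDislocations → SmallFieldQuarkRG → RobustYMInfrared foreseen below is the internal structure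
of ThresholdQCD (route HeavyThresholdYMBridge: RobustYangMillsRG 14958 → ConstructiveDecouplingRG
14667), not of B directly. Foreseen glued splits (k ≤ 3, depth 1), filed only when a crux closes: B
⇐ DiluteDislocations (Peierls/percolation from A: bad
plaquettes form finite clusters with exponential size tails, uniformly in k and volume) →
SmallFieldQuarkRG (Balaban–O'Carroll–Schor
block fermions driven by a dynamical SU(3) field inside δ-good regions, m_crit(k) tuning, Gram
bounds) → RobustYMInfrared (uniform
physical-unit clustering for the pure-gauge-type improved measure + AP-even → periodic-odd transfer)
→ B. A ⇐ MarginalSiteRP (all four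
axes) → ChessboardIteration (plaquette events as cell-face observables, FILS Thm 2.2 on the even
4-torus) → PatternBound (two-sided
determinant bounds + transfer-matrix lower bound Z_AP ≥ e^{−cL⁴}) → A. S ⇐ WeakFieldBound (one-loop:
Π_W(p;m) ≥ −c₂K_W(p) on the
Brillouin zone, exact second order + remainder) → DefectLocality (O(1) response of log|det| to a
local change, 4D integrability of
G² at m = 0) → S. CriticalLineDiamagnetism ⇐ SmallHoppingDiamagnetism → BZPositivity (Π_W ≥ c₁K_W at
m ≈ 0) → extension.

KILL CRITERIA. A smooth-field or flat-holonomy witness U with |det D_AP[U,m]| > e^{K + c₂S_good + C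
N_bad} det D_AP[𝟙,m] for all admissible constants
(i.e. super-linear growth in S_good, or a holonomy sector beating AP-trivial by a volume-growing
factor) refutes WilsonQuarkStability:
close `refuted:WilsonQuarkStability` unless the witness is a pure reference artefact, in which case
restate ONCE with reference
max over flat connections. Refutation of CriticalLineDiamagnetism alone (c₁ ≤ 0 somewhere in the
zone; kit j000738 PART A) ⇒ `--drop`
it (not load-bearing) and record the paramagnetic momenta as negative knowledge for the sibling
card. Refutation of
UnquenchedChessboardBound AS TYPED (e.g. signed normalisation for odd N_f) ⇒ restate to even N_f /
pairwise-degenerate masses or to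
link reflections — a pivot, not a close; refutation of its RP lemma MarginalSiteRP for antiperiodic
quarks would close the route
(`refuted:UnquenchedChessboardBound`). B cannot be refuted without refuting QCD. Mooted by: any
route proving QCD; absorbed by: a
Balaban-type UV-stability theorem with dynamical fermions elsewhere (A, S become its lemmas).

NOT DECOMPOSED YET. (B itself IS decomposed since 2026-08-17 — see DECOMPOSITION OF #5; what follows
concerns A, S, #2 and the inside of ThresholdQCD.) Constants c(δ), C_f and the β-polynomial
prefactors; the transfer-matrix lower bound on the signed Z_AP; the Peierls/percolation step
(DiluteDislocations); the interface "chessboard probabilities at the bare scale vs conditional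
densities at coarser scales"; the
AP-even → periodic-odd boundary-condition transfer (Roberge–Weiss: periodic SU(3) quarks sit at
imaginary chemical potential π ≢ 0 mod
2π/3, so the two families differ at finite volume); the whole small-field fermionic RG and the
Yang–Mills infrared (children of B);
the extension of diamagnetism from κ ≤ κ₀ to κ ≈ 1/8. All are layer-2 children or prover-attached
lemmas (`--supports`).

CHEAPEST FALSIFIER. RUN before open (kit j000841; falsifier/main.py + outputs/results.json in the
session folder; superset j000738 running at open).
PART A, one-loop sign over the Brillouin zone: R = S_f/S_W for weak plane waves exp(i t ε_μ cos(p·x)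
diag(1,−1,0)) at every momentum
class × polarisation of the 4⁴ and 6⁴ antiperiodic tori, m ∈ {0, −0.1}: ALL POSITIVE (L = 6, m = 0:
min +0.00637 at p = (π,π,π,π),
max +0.0358 at the smallest momentum; m = −0.1: +0.00725 … +0.0409; #negative = 0) — the
weak-plane-wave refutation of
CriticalLineDiamagnetism FAILED. PART B vs det D_AP[𝟙]: constant flux 2πn/L², π-flux sheets,
Haar-random U(1)/SU(3) fields,
temporal and all-four holonomy twists up to θ = π: every tested field has |det D_AP[U]| < det
D_AP[𝟙] (numbers under NUMBERS).
Still cheap and untried: the scan at L = 8–12; moderate-amplitude non-abelian waves and lattice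
instantons (third order and beyond);
the closed-form one-loop Wilson vacuum polarisation (MontvayMunster1994 (5.81)) minimised over the
infinite-volume zone. For
UnquenchedChessboardBound: the two-time-slice toy of Lüscher's site-RP with an antiperiodic seam and
Grassmann-free F.

NUMBERS. κ = 1/(2m+8); site-RP range |κ| < 1/6 ⟺ m > −1 (MontvayMunster1994 (4.111)), link-RP all κ
for |r| ≤ 1 (ibid. p. 184); ‖H[U]‖₂ ≤ 8
for every U (r = 1) ⟹ the hopping expansion converges absolutely for m > 0 (and diverges at U = 𝟙
for m ≤ 0); continuum limit κ → κ_c → 1/8 (ibid. §4.2.3), so the statement's bare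
masses m_f(k) = m_crit(k) + a_k m_f/Z_m(k) enter any [−ε, ε] eventually — the window of S and of the
rank-2 crux. Plaquette spin trace
tr[(1−γ_μ)(1−γ_ν)(1+γ_μ)(1+γ_ν)] = −8, 8 rooted orientations per plaquette ⟹ log det(1 − κH) ∋ +16κ⁴
Σ_p Re tr U_p per flavour, i.e.
S_f = 16κ⁴ S_W + O(κ⁶) = the familiar unquenching shift Δβ_W = 48 N_f κ⁴ (HasenfratzDegrand1994); at
κ = 1/8 this is R₄ = 0.0039,
while the measured one-loop ratio on 6⁴ is R(p) ∈ [0.0064, 0.036] (kit j000841) and Haar-random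
SU(3) fields give S_f/S_W = 0.0105 per
flavour (m = 0): empirically −log|det D_AP[U]/det D_AP[𝟙]| ≈ (0.006–0.09)·S_W(U) > 0 on every tested
field, smooth or rough.
Kit j000841 PART B (L = 6, m = 0 unless said): constant (0,1)-flux n = 1…18: S_f/S_W = 0.085, 0.040,
0.030, 0.025, 0.022, 0.019 … 0.010
(monotone in n, flux π last); π-flux in 1/2/5 planes 0.0102/0.0091/0.0056; Haar U(1) 0.0076; Haar
SU(3) (L = 4) 0.0105 ± 0.0001 per
flavour (0.0118 at m = −0.1); temporal holonomy θ = π/6 … π: Δlog|det| = −0.07, −0.27, −0.54, −0.81,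
−1.00, −1.08 (periodic quarks
lose to antiperiodic; centre sector 2π/3 at −0.81); all-four twists 2π/3, π: −4.44, −144.4 (zero
mode of the fully periodic free
operator). L = 4 reproduces every sign and ordering; quadratic scaling of PART A verified to 5
digits (t = 0.01 vs 0.02).
b₀ = (11 − 2N_f/3)/(16π²) ≈ 0.057 (N_f = 3): a bare-scale dislocation of plaquette deficit δ ≤ 4.5
has density a⁻⁴(aΛ)^{4b₀δ} per
physical volume, exponent 4b₀δ − 4 < 0 — so A delivers rarity in LATTICE units (≤ C e^{−cβ_k} per
plaquette, β_k ≍ 4b₀ log(1/a_kΛ)),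
never in physical units; B must live with dilute-but-present unit-scale dislocations (as Balaban's
large-field regions do).
Per-cell fermion entropy in the chessboard pattern bound: c_f(m) := sup_U L⁻⁴ log|det D_AP[U,m]| −
L⁻⁴ log det D_AP[𝟙,m] < ∞ for every
m > −1 (Hadamard above, free antiperiodic spectrum below; an O(10) constant per flavour), versus
gauge cost ≍ βδ/4 per cell. Items at open: 9 (4 cruxes, target, assembly, 3 support).

DEFINITION REQUESTS. To be filed after open (convenience only — every signature above elaborates
without them, Sketch.lean rc 0): `wilsonDiracAP` (the
r = 1 Wilson–Dirac operator with antiperiodic quarks, = `wilsonDirac (unitaryFundamentalRep (Fin 3)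
ℂ)` of the U(3)-lift with the seam
links x_μ = −1 negated — inlined four times above), `plaquetteDeficit U p := 3 − Re tr U_p` and
`badCount δ U`, topic
Summits/QuantumFields/QCD/Theorems; a later `route edit --restate` may shorten the signatures once
they land. No cite facts are used as
hypotheses: every crux is a self-contained statement over tree objects (`GaugeConfig`,
`plaquetteHolonomy`, `wilsonMeasure`,
`wilsonDirac`, `fermionDet`, `GaugeConfig.timeReflect`; the unit time shift in MarginalSiteRP is
INLINED as `U (e.1 - Pi.single 0 1, e.2)`).
IMPORT CONE (route-repair rev 3–4, 2026-08-15): the file imports only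
`Summits.QuantumFields.Statement` — do NOT re-add
`Literature.MathematicalPhysics.QuantumFieldTheory.TorusSiteRP` or use `torusConfigShift` (home:
LatticeGaugeProofs): that chain
(TorusLoopReflection → LatticeGaugeProofs → LatticeGauge → Sweep1, and ConstructiveQFTWave0Proofs →
StrongCouplingActivities → Sweep1)
drags 6 unprovable-or-open named facts (ChatterjeeMassGapProblem, LatticeMassGapAllCouplings,
shenZhuZhu_strongCoupling,
chatterjee_isingGauge_wilsonLoop, aizenmanDuminilCopin_gaussian_limit,
aizenmanDuminilCopin_charFun_bound) into the prover guardrail's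
module cone and starves the route of provers. What remains in the cone is exactly the cone of
QCD/Statement.lean itself (shared by every
QuantumFields route): the dischargeable sanity fact
`Literature.MathematicalPhysics.QuantumLattice.not_isSimpleCompactGroup_unitaryGroup`
(needs-fact, tier-0) and the open-problem registrations ClayYangMillsEuclidean{,Gap,Along} /
CaoParkSheffieldProblem (census hygiene, not facts).

Novelty: Searches (2026-08-15): `lit search --hybrid "site reflection positivity Wilson fermions hopping
parameter transfer matrix Lüscher 1/6"`
(10 docs; MontvayMunster1994 PDF pp. 181–185 read: link-RP |r| ≤ 1 all K, site-RP r = 1 |K| < 1/6,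
antiperiodic ⇔ trace);
`lit galaxy search "chessboard estimate" --star all` (24 rows: FILS/Fröhlich–Lieb lineage,
KoteckyShlosman1982, Gruber–Macris
Falicov–Kimball review, KovacsTomboulis1998 = chessboard in SU(2) LGT for vortex free energies;
nothing with fermion determinants);
`lit galaxy search "chessboard estimates for lattice gauge theories" --star pdf` (0); `"effective
gauge action induced by the fermion
determinant" --star all` (0); `"paramagnetic conjecture" --star all` (2: CFKS Schrödinger Operators,
Osterwalder LNP116); `lit frontier
QuantumFields --since 2020` (30 rows: arXiv:2401.10507 SU(2) YM–Higgs scaling limit,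
arXiv:2606.19362 RP-construction claim; none on
determinant positivity); `lit bridges QuantumFields --cross any` (30 rows, percolation/Ising; none);
`ledger negatives --problem
QuantumFields` (0); the 38 QCD cards in Summits/QuantumFields/QCD/Ideas (nearest:
quark-determinant-chessboard, pathwise Schwarz at a
fixed background; twisted-lattice-vafa-witten; heavy-threshold-robust-ym-bridge). Card-level
searches (vsearch ×3, hybrid ×1, liebnd
grep) are recorded on the card.
Nearest prior art found: KennedyLieb1986 (RP after fermion integration + Peierls/chessboard,
Falicov–Kimball); BorgsSeiler1983 and
KovacsTomboulis1998 (R  [refs: 2401.10507, 2606.19362, MontvayMunster1994, KoteckyShlosman1982, KovacsTomboulis1998, KennedyLieb1986, BorgsSeiler1983, Lieb1994, LiebLoss1993, HasenfratzDegrand1994, HogreveSchraderSeiler1978, BrydgesFrohlichSeiler1979]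

Barriers (technique_class: reflection-positivity, chessboard, det-inequality): - technique_class: reflection-positivity, chessboard, det-inequality
- Literature.Barriers.QuantumFields.HoppingExpansionUniformGap: evaded — A holds on the whole
site-RP range κ < 1/6 and S / CriticalLineDiamagnetism are stated AT |m| ≤ ε around κ = 1/8, where
nothing is expanded; only the support rung SmallHoppingDiamagnetism lives inside the convergence
disc m > 0, as the κ ≤ κ₀ anchor of the sign.
- Literature.Barriers.QuantumFields.HoppingExpansionLocality: same; the locality used is that of the
induced ACTION (plaquette deficits, bad-plaquette counts), not propagator decay, and it is claimed
as an inequality, not via a convergent series.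
- Literature.Barriers.QuantumFields.WilsonDeterminantSign: evaded — A is stated for the SIGNED
functional with any N_f and split masses: marginal RP and the Schwarz iteration never use positivity
of the weight, the universal-pattern expectations are RP squares ≥ 0, and the normalisation is the
trace of a positive transfer matrix; S and the rank-2 crux bound |det| per flavour, where the sign
is irrelevant.
- Literature.Barriers.QuantumFields.WilsonDeterminantMassSplitting: same evasion (masses enter
flavour by flavour; no det² ≥ 0 is used).
- Literature.Barriers.QuantumFields.UVStabilityNonUniqueness: A and S are stability INPUTS; the
statement (ruling Y2, `IsQCDAlong` along the witness's own sequence) asks existence along a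
sequence, which uniform bounds + compactness can deliver — B still owes uniform bounds for all
n-point functions a

Novelty grade: new-combination — ROUTE REVIEW (refuter rreview-0815T14-4). new-combination: KennedyLieb1986 (integrate fermions, keep RP, run Peierls/chessboard) + FILS 1978/80 chessboard (LGT: BorgsSeiler1983, KovacsTomboulis1998) transplanted to SU(3) Wilson-quark QCD via Lüscher/OS joint site-RP (r=1, κ<1/6), with background-fie (refuter refuter-rreview-0815T14-4-0, 2026-08-15T15:02:28Z; prior: KennedyLieb1986, FrohlichIsraelLiebSimon1978, BorgsSeiler1983, Luscher1977, HogreveSchraderSeiler1978)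

History (route lifecycle, newest last):
- 2026-08-15T14:24:23Z · rev 1: dropped Target — Target was the optional restatement X = A ∧ S ∧ B; the renderer writes rank 0 first, so it cannot reference its conjunct decls and was materialised as a BLOCKED (planner-plancard-QuantumFields-QCD-quarks-as--d6e453f8-0)
- 2026-08-16T15:37:48Z · rev 5: restated Assembly (stmt-QuantumFields-9741 proved) — route-repair (ground-failed, rground 99984cc1): the only blocking ground flag (payload.ground ts 2026-08-16T15:23:06Z) was Assembly (stmt-QuantumFields-9741) gr (planner-rground-QuantumFields-QuarksAsStableAct-99984cc1-0)
- 2026-08-25T06:27:50Z · DORMANT — reconciler: no traction for 7.5 d (last activity statement-checked at 2026-08-17T19:04:04Z); parked, not closed — `ledger route dormant route-QuantumFields-Quar (operator:999:1482183)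

sub-problem: QCD · status: dormant · opened planner-plancard-QuantumFields-QCD-quarks-as--d6e453f8-0 2026-08-15T14:16:55Z · rev 11 · ledger route-QuantumFields-QuarksAsStableAction
GENERATED by the gate from the ledger (D-0016/17). Provers cite these decls: `theorem foo : Summit.QuantumFields.QCD.Theses.QuarksAsStableAction.<Decl> := …` in Summits/QuantumFields/QCD/Theorems/<Name>.lean.
-/

namespace Summit.QuantumFields.QCD.Theses.QuarksAsStableAction

open scoped BigOperators Topology Manifold Classical MeasureTheory ProbabilityTheory Matrix InnerProductSpace ComplexConjugate ContinuousMap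
open Filter Set Function TopologicalSpace MeasureTheory

attribute [summit_statement] _root_.QCD

/-- item stmt-QuantumFields-9734 · crux · rank 2 · open · by planner
why it might fail: Strict c₁>0 for ALL U, uniform in L, at |m|≤ε: one-loop margin only +0.64% of S_W at p=(π,π,π,π) on 6⁴ (kit j000841); full-zone L→∞ infimum and cubic/quartic orders in lattice-scale fields unchecked; for naive hopping determinants π-flux, not zero flux, maximises |det| (LiebLoss1993 Thm 3.1).
sources: LiebLoss1993, Lieb1994, HogreveSchraderSeiler1978, arXiv:hep-th/9611055, HasenfratzDegrand1994, BrydgesFrohlichSeiler1979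
[crux] [card conjecture (B), sharp form] there are ε, δ, c₁ > 0, constants K, C and L₀ such that for
every torus side L ≥ L₀, every bare mass |m| ≤ ε (κ = 1/(2m+8) near 1/8) and EVERY SU(3) gauge field
U, the r = 1 Wilson determinant with antiperiodic quarks (seam: links leaving the slice x_μ = −1
sign-flipped in U(3)) satisfies |det D_AP[U,m]| ≤ exp(K − c₁·S_good(U) + C·N_bad(U))·|det
D_AP[𝟙,m]|, where S_good = Σ over plaquettes with deficit 3 − Re tr U_p < δ of the deficit and N_bad
= #{p : deficit ≥ δ}: curvature strictly LOWERS |det| (Wilson quarks are diamagnetic), up to an O(1)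
price per dislocation and an O(1) finite-volume constant. [difficulty: L] -/
@[route_item "route-QuantumFields-QuarksAsStableAction"]
def CriticalLineDiamagnetism : Prop :=
  ∃ ε δ c₁ K C : ℝ, 0 < ε ∧ 0 < δ ∧ 0 < c₁ ∧ ∃ L₀ : ℕ, ∀ (L : ℕ) [NeZero L], L₀ ≤ L → let apDet : Literature.MathematicalPhysics.QuantumFieldTheory.GaugeConfig 4 L (Matrix.specialUnitaryGroup (Fin 3) ℂ) → ℝ → ℂ := fun U m => Literature.MathematicalPhysics.QuantumLattice.fermionDet (Literature.MathematicalPhysics.QuantumLattice.wilsonDirac (Literature.MathematicalPhysics.QuantumLattice.unitaryFundamentalRep (Fin 3) ℂ) (fun e => if e.1 e.2 = -1 then -(⟨(U e).1, Matrix.specialUnitaryGroup_le_unitaryGroup (U e).2⟩ : Matrix.unitaryGroup (Fin 3) ℂ) else ⟨(U e).1, Matrix.specialUnitaryGroup_le_unitaryGroup (U e).2⟩) m 1); let dfc : Literature.MathematicalPhysics.QuantumFieldTheory.GaugeConfig 4 L (Matrix.specialUnitaryGroup (Fin 3) ℂ) → Literature.MathematicalPhysics.QuantumFieldTheory.Plaquette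 4 L → ℝ := fun U p => 3 - (Literature.MathematicalPhysics.QuantumLattice.fundamentalRep (Fin 3) (Literature.MathematicalPhysics.QuantumFieldTheory.plaquetteHolonomy U p.1 p.2.1.1 p.2.1.2)).trace.re; ∀ m : ℝ, |m| ≤ ε → ∀ U : Literature.MathematicalPhysics.QuantumFieldTheory.GaugeConfig 4 L (Matrix.specialUnitaryGroup (Fin 3) ℂ), ‖apDet U m‖ ≤ Real.exp (K - c₁ * (∑ p ∈ Finset.univ.filter (fun p => dfc U p < δ), dfc U p) + C * ((Finset.univ.filter (fun p => δ ≤ dfc U p)).card : ℝ)) * ‖apDet 1 m‖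

/-- item stmt-QuantumFields-9735 · crux · rank 3 · closed · proved by Summit.QuantumFields.QCD.Theorems.UnquenchedChessboardBoundLine.UnquenchedChessboardBound_of @ 7fc9cebcc414 (prover) · by planner
why it might fail: Needs marginal SITE-RP in all 4 axes for r=1 AP quarks on even tori (proved only for |K|<1/6, even shifts: MontvayMunster1994 (4.111) p.184), chessboard bookkeeping for plaquette events straddling cells, and an e^{−O(L⁴)} lower bound on the SIGNED Z (odd N_f, m_f<0 allowed: sign (−1)^index).
sources: FrohlichIsraelLiebSimon1978, FrohlichIsraelLiebSimon1980, KennedyLieb1986, Luscher1977, OsterwalderSeilerAnnPhys1978, MenottiPelissetto1987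
[crux] [card engine (A)/P1] for every N_f, every mass window [m_lo, m_hi] with m_lo > −1 and every δ
> 0 there are C, c > 0, β₀ such that for all β ≥ β₀, all EVEN L ≥ 4, all bare masses m_f in the
window and all sets R of plaquettes: |∫_{all p∈R δ-bad} ∏_f det D_AP[U, m_f] dμ_W,β(U)| / |∫ ∏_f det
D_AP[U, m_f] dμ_W,β(U)| ≤ (C e^{−cβ})^{|R|} (μ_W,β = SU(3) Wilson probability measure; D_AP the
antiperiodic r = 1 Wilson–Dirac operator; signed determinants, any N_f, split masses). Route of
proof: marginal site-RP in all four axes (MarginalSiteRP) ⇒ FILS chessboard ⇒ universal bad pattern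
bounded by crude two-sided determinant bounds and a transfer-matrix lower bound on the signed
partition function. [deps: MarginalSiteRP] [difficulty: L] -/
@[route_item "route-QuantumFields-QuarksAsStableAction", crux]
def UnquenchedChessboardBound : Prop :=
  ∀ (Nf : ℕ) (mlo mhi δ : ℝ), -1 < mlo → 0 < δ → ∃ C c β₀ : ℝ, 0 < c ∧ ∀ β : ℝ, β₀ ≤ β → ∀ (L : ℕ) [NeZero L], Even L → 4 ≤ L → let apDet : Literature.MathematicalPhysics.QuantumFieldTheory.GaugeConfig 4 L (Matrix.specialUnitaryGroup (Fin 3) ℂ) → ℝ → ℂ := fun U m => Literature.MathematicalPhysics.QuantumLattice.fermionDet (Literature.MathematicalPhysics.QuantumLattice.wilsonDirac (Literature.MathematicalPhysics.QuantumLattice.unitaryFundamentalRep (Fin 3) ℂ) (fun e => if e.1 e.2 = -1 then -(⟨(U e).1, Matrix.specialUnitaryGroup_le_unitaryGroup (U e).2⟩ : Matrix.unitaryGroup (Fin 3) ℂ) else ⟨(U e).1, Matrix.specialUnitaryGroup_le_unitaryGroup (U e).2⟩) m 1); let dfc : Literature.MathematicalPhysics.QuantumFieldTheory.GaugeConfig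 4 L (Matrix.specialUnitaryGroup (Fin 3) ℂ) → Literature.MathematicalPhysics.QuantumFieldTheory.Plaquette 4 L → ℝ := fun U p => 3 - (Literature.MathematicalPhysics.QuantumLattice.fundamentalRep (Fin 3) (Literature.MathematicalPhysics.QuantumFieldTheory.plaquetteHolonomy U p.1 p.2.1.1 p.2.1.2)).trace.re; ∀ m : Fin Nf → ℝ, (∀ f, mlo ≤ m f ∧ m f ≤ mhi) → ∀ R : Finset (Literature.MathematicalPhysics.QuantumFieldTheory.Plaquette 4 L), ‖(∫ U in {U | ∀ p ∈ R, δ ≤ dfc U p}, (∏ f, apDet U (m f)) ∂(Literature.MathematicalPhysics.QuantumFieldTheory.wilsonMeasure (d := 4) (L := L) (Literature.MathematicalPhysics.QuantumLattice.fundamentalRep (Fin 3)) β)) / (∫ U, (∏ f, apDet U (m f)) ∂(Literature.MathematicalPhysics.QuantumFieldTheory.wilsonMeasure (d := 4) (L := L) (Literature.MathematicalPhysics.QuantumLattice.fundamentalRep (Fin 3)) β))‖ ≤ (C * Real.exp (-c * β)) ^ R.card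

/-- item stmt-QuantumFields-9736 · crux · rank 4 · closed · proved by Summit.QuantumFields.QCD.Cruxes.WilsonQuarkStability.FreeTangentLandauChessboard.WilsonQuarkStability_of @ ef98013e14fb (prover) · by planner
why it might fail: ∀U, one (K,c₂,C) uniform in L, |m|≤ε incl. m<0, where the γ₅D_W gap closes (EdwardsHellerNarayanan1998); no O(1)-per-dislocation / linear-in-S_good bound on log|det D_W| known at κ≈1/8 (massless quark, block fermions need small fields); a rough sub-threshold family super-linear in S_good kills it
sources: BalabanOcarrollSchor1989, HogreveSchraderSeiler1978, BrydgesFrohlichSeiler1979, EdwardsHellerNarayanan1998, arXiv:hep-th/9611055, MontvayMunster1994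
[crux] [load-bearing weak form of (B)] there are ε, δ > 0, constants K, c₂, C and L₀ such that for
all L ≥ L₀, |m| ≤ ε and all SU(3) gauge fields U: |det D_AP[U,m]| ≤ exp(K + c₂·S_good(U) +
C·N_bad(U))·|det D_AP[𝟙,m]| — the quark effective action relative to the antiperiodic free
determinant is bounded BELOW by −c₂·(Wilson action of good plaquettes) − C·(number of bad
plaquettes) − K, uniformly in the volume, for bare masses around the critical region κ ≈ 1/8: quarks
are a stable (Wilson-dominated) action. [difficulty: L] -/
@[route_item "route-QuantumFields-QuarksAsStableAction", crux]
def WilsonQuarkStability : Prop :=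
  ∃ ε δ K c₂ C : ℝ, 0 < ε ∧ 0 < δ ∧ ∃ L₀ : ℕ, ∀ (L : ℕ) [NeZero L], L₀ ≤ L → let apDet : Literature.MathematicalPhysics.QuantumFieldTheory.GaugeConfig 4 L (Matrix.specialUnitaryGroup (Fin 3) ℂ) → ℝ → ℂ := fun U m => Literature.MathematicalPhysics.QuantumLattice.fermionDet (Literature.MathematicalPhysics.QuantumLattice.wilsonDirac (Literature.MathematicalPhysics.QuantumLattice.unitaryFundamentalRep (Fin 3) ℂ) (fun e => if e.1 e.2 = -1 then -(⟨(U e).1, Matrix.specialUnitaryGroup_le_unitaryGroup (U e).2⟩ : Matrix.unitaryGroup (Fin 3) ℂ) else ⟨(U e).1, Matrix.specialUnitaryGroup_le_unitaryGroup (U e).2⟩) m 1); let dfc : Literature.MathematicalPhysics.QuantumFieldTheory.GaugeConfig 4 L (Matrix.specialUnitaryGroup (Fin 3) ℂ) → Literature.MathematicalPhysics.QuantumFieldTheory.Plaquette 4 L → ℝ := fun U p => 3 - (Literature.MathematicalPhysics.QuantumLattice.fundamentalRep (Fin 3) (Literature.MathematicalPhysics.QuantumFieldTheory.plaquetteHolonomy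 U p.1 p.2.1.1 p.2.1.2)).trace.re; ∀ m : ℝ, |m| ≤ ε → ∀ U : Literature.MathematicalPhysics.QuantumFieldTheory.GaugeConfig 4 L (Matrix.specialUnitaryGroup (Fin 3) ℂ), ‖apDet U m‖ ≤ Real.exp (K + c₂ * (∑ p ∈ Finset.univ.filter (fun p => dfc U p < δ), dfc U p) + C * ((Finset.univ.filter (fun p => δ ≤ dfc U p)).card : ℝ)) * ‖apDet 1 m‖

/-- item stmt-QuantumFields-9737 · crux · rank 5 · open · by planner
why it might fail: Since re-type p117723 the conclusion QCD conjoins reg.IsChiralAtZero: on top of UV stability with dynamical Wilson quarks + YM infrared + AP-even→periodic-odd transfer (threshold regime = ThresholdQCD) it needs a chiral completion (pinned m_crit, light quarks, gap→0) beyond RP/chessboard/stability.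
sources: Balaban1989LargeFieldII, Balaban1988Convergent, Balaban1987RG1, BalabanOcarrollSchor1989, Dimock2022QED3, JaffeWitten2000
[crux] A → S → QCD: given the chessboard large-field bound for the AP-even unquenched family and the
stability bound on the Wilson-quark determinant, construct for N_f = 2 and N_f = 3 a
mass-independent regularisation with leading-log mass scaling along which honest lattice QCD has a
volume-uniform lattice gap and OS continuum limits with non-trivial glue and dynamical quarks
(`QCDOf 2 ∧ QCDOf 3`): a block renormalisation group treating e^{−βS_W} ∏_f det D as a pure-gauge
measure with a positive quasi-local improvement (small-field fermionic perturbation theory with Gram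
bounds inside δ-good regions, chessboard rarity of bad regions at the bare scale, Peierls
diluteness), followed by the Yang–Mills infrared for that measure and the transfer from AP-even tori
to the statement's periodic odd tori. [deps: UnquenchedChessboardBound, WilsonQuarkStability]
[difficulty: open-problem] -/
@[route_item "route-QuantumFields-QuarksAsStableAction", crux]
def StableActionBridge : Prop :=
  UnquenchedChessboardBound → WilsonQuarkStability → _root_.QCD

/-- item stmt-QuantumFields-18327 · crux · rank 6 · open · by planner
why it might fail: Needs uniform-in-k complex-bare-mass bounds (Lee–Yang-type zeros may pinch the real axis below M if a lattice-artefact transition — Aoki/first-order, Sharpe–Singleton — survives in renormalised units) and Vitali convergence of the SAME sequence; non-triviality could fail at isolated masses.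
sources: SharpeSingleton1998, Aoki1984WilsonPhase, MontvayMunster1994, LeeYang1952, VafaWitten1984, GlimmJaffe1987
[crux] piece 2 of the strategist's decomposition of StableActionBridge (stmt-QuantumFields-9737;
EXEMPT-46 TRIVIAL-SEAM fix) (THE MASSIVE PHASE IS OPEN BELOW A UNIFORMLY GAPPED THRESHOLD — the
uniform-in-mass UV/IR stability input): for N_f ∈ {2,3}, every mass-scaling regularisation reg,
every real M and rate ε > 0: IF the QCDOf body holds at every tuple with all components > M AND the
lattice gap has the ONE rate ε on that whole half-orthant ((reg.scheme m 0 0).HasLatticeMassGap ε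
for all m > M), THEN for some δ > 0 the body holds at every tuple with all components > M − δ.
Physics: the body above M forces an honest asymptotically free regularisation with a finite
flavour-blind chiral offset M_χ ≤ M; a uniform rate down to the corner M means M > M_χ strictly
(Goldstone: the gap closes continuously at M_χ, m_π² ≍ B·m_q), and massive QCD continues on (M_χ,
M]: lattice expectations are analytic in the bare mass, uniform complex-mass bounds from the gap
give Vitali convergence of the SAME sequence k at the new masses, OS limits, non-triviality and a
gap ≥ ε/2 persist. Consumed by the proved assembly at the least admissible threshold M⋆ = sInf{M |
body above M}: closure of the gap abov -/
@[route_item "route-QuantumFields-QuarksAsStableAction", crux]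
def MassContinuation : Prop :=
  ∀ Nf : ℕ, Nf = 2 ∨ Nf = 3 → ∀ (reg : Literature.MathematicalPhysics.QuantumFieldTheory.QCDRegularisation Nf) (M ε : ℝ), reg.HasMassScaling → 0 < ε → (∀ m : Fin Nf → ℝ, (∀ f, M < m f) → ∃ (z shift : Literature.MathematicalPhysics.QuantumFieldTheory.QCDField Nf → ℕ → ℝ) (T : Literature.MathematicalPhysics.QuantumFieldTheory.OSData (Literature.MathematicalPhysics.QuantumFieldTheory.QCDField Nf) 4), Literature.MathematicalPhysics.QuantumFieldTheory.IsQCDAlong (reg.scheme m z shift) T ∧ T.IsNontrivial Literature.MathematicalPhysics.QuantumFieldTheory.QCDField.glue ∧ T.IsNonGaussian Literature.MathematicalPhysics.QuantumFieldTheory.QCDField.glue ∧ (∀ f g : Fin Nf, f ≠ g → T.IsNontrivial (Literature.MathematicalPhysics.QuantumFieldTheory.QCDField.pseudoRe f g)) ∧ ∃ Δ > 0, T.HasMassGap Δ ∧ (reg.scheme m z shift).HasLatticeMassGap Δ) → (∀ m : Fin Nf → ℝ, (∀ f, M < m f) → (reg.scheme m 0 0).HasLatticeMassGap ε) → ∃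 δ > 0, ∀ m : Fin Nf → ℝ, (∀ f, M - δ < m f) → ∃ (z shift : Literature.MathematicalPhysics.QuantumFieldTheory.QCDField Nf → ℕ → ℝ) (T : Literature.MathematicalPhysics.QuantumFieldTheory.OSData (Literature.MathematicalPhysics.QuantumFieldTheory.QCDField Nf) 4), Literature.MathematicalPhysics.QuantumFieldTheory.IsQCDAlong (reg.scheme m z shift) T ∧ T.IsNontrivial Literature.MathematicalPhysics.QuantumFieldTheory.QCDField.glue ∧ T.IsNonGaussian Literature.MathematicalPhysics.QuantumFieldTheory.QCDField.glue ∧ (∀ f g : Fin Nf, f ≠ g → T.IsNontrivial (Literature.MathematicalPhysics.QuantumFieldTheory.QCDField.pseudoRe f g)) ∧ ∃ Δ > 0, T.HasMassGap Δ ∧ (reg.scheme m z shift).HasLatticeMassGap Δ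

/-- item stmt-QuantumFields-8794 · crux · rank 7 · open · by planner
why it might fail: Contains robust SU(3) Yang–Mills (glueball gap along AF sequences) and UV stability with DYNAMICAL Wilson quarks (block fermions exist only for small/external fields); flavour-blind m_crit must serve split masses; A gives bare-scale rarity, not per-scale conditional densities.
sources: JaffeWitten2000, Balaban1989LargeFieldII, Balaban1988Convergent, BalabanOcarrollSchor1989, Dimock2022QED3, MontvayMunster1994
[target] for N_f ∈ {2, 3} there are M₀ ≥ 0 and a mass-independent regularisation reg with
HasMassScaling such that for every mass tuple with all m_f > M₀ there are species renormalisations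
z, shift and OS data T with IsQCDAlong (reg.scheme m z shift) T, IsNontrivial and IsNonGaussian
glue, IsNontrivial (pseudoRe f g) for all f ≠ g, and one Δ > 0 with T.HasMassGap Δ and (reg.scheme m
z shift).HasLatticeMassGap Δ — the threshold form of QCDOf 2 ∧ QCDOf 3 (card
heavy-threshold-robust-ym-bridge, thesis X). -/
@[route_item "route-QuantumFields-QuarksAsStableAction", crux]
def ThresholdQCD : Prop :=
  ∀ Nf : ℕ, Nf = 2 ∨ Nf = 3 → ∃ M₀ : ℝ, 0 ≤ M₀ ∧ ∃ reg : Literature.MathematicalPhysics.QuantumFieldTheory.QCDRegularisation Nf, reg.HasMassScaling ∧ ∀ m : Fin Nf → ℝ, (∀ f, M₀ < m f) → ∃ (z shift : Literature.MathematicalPhysics.QuantumFieldTheory.QCDField Nf → ℕ → ℝ) (T : Literature.MathematicalPhysics.QuantumFieldTheory.OSData (Literature.MathematicalPhysics.QuantumFieldTheory.QCDField Nf) 4), Literature.MathematicalPhysics.QuantumFieldTheory.IsQCDAlong (reg.scheme m z shift) T ∧ T.IsNontrivial Literature.MathematicalPhysics.QuantumFieldTheory.QCDField.glue ∧ T.IsNonGaussian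 Literature.MathematicalPhysics.QuantumFieldTheory.QCDField.glue ∧ (∀ f g : Fin Nf, f ≠ g → T.IsNontrivial (Literature.MathematicalPhysics.QuantumFieldTheory.QCDField.pseudoRe f g)) ∧ ∃ Δ > 0, T.HasMassGap Δ ∧ (reg.scheme m z shift).HasLatticeMassGap Δ

/-- item stmt-QuantumFields-18328 · crux · rank 8 · open · by planner
why it might fail: Needs a Goldstone/anomaly LOWER bound on a lattice two-point function at the chiral tuple uniformly along the AF sequence (no OS-level proof of gaplessness of massless N_f=2,3 QCD exists), and non-vanishing of the (−1)^F-twisted signed partition function there (junk value 0 would fake decay).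
sources: GellmannOakesRenner1968, GasserLeutwyler1984, tHooft1980Naturalness, VafaWitten1984, SharpeSingleton1998, EdwardsHellerNarayanan1998
[crux] piece 3 of the strategist's decomposition of StableActionBridge (stmt-QuantumFields-9737;
EXEMPT-46 TRIVIAL-SEAM fix) (THE GAPLESSNESS INPUT — the chiral tuple exists and is gapless): for
N_f ∈ {2,3}, every mass-scaling regularisation reg that carries the QCDOf body at every tuple of
some half-orthant {m > M} has a renormalised mass tuple m₀ at which the lattice theory (bare
trajectory m_crit(k) + a_k m₀/Z_m(k)) has NO uniform lattice gap at ANY positive rate in physical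
units: ∀ Δ > 0, ¬ (reg.scheme m₀ 0 0).HasLatticeMassGap Δ. Physics: the body with dynamical
(non-decoupled) quarks and convergence along the full sequence pins m_crit(k) = m_c(β_k) + a_k
M_χ/Z_m(k) + o(a_k/Z_m(k)) with a FINITE chiral offset M_χ; at the flavour-symmetric tuple M_χ·1 the
lattice pion mass E_k → 0 in physical units (massless N_f = 2, 3 QCD is gapless: Goldstone pions if
chiral symmetry breaks, massless baryons by 't Hooft anomaly matching otherwise; in both
Sharpe–Singleton scenarios E_k ≤ c·a_kΛ² → 0), so for every Δ > 0 the pion two-point function at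
separations n = S → ∞ beats C e^{−Δ a_k n} frequently in k. Consumption lemma landed:
Cruxes.StableActionBridge.Sketch.not_hasLatticeMassGap_of -/
@[route_item "route-QuantumFields-QuarksAsStableAction", crux]
def ChiralTupleGapless : Prop :=
  ∀ Nf : ℕ, Nf = 2 ∨ Nf = 3 → ∀ (reg : Literature.MathematicalPhysics.QuantumFieldTheory.QCDRegularisation Nf) (M : ℝ), reg.HasMassScaling → (∀ m : Fin Nf → ℝ, (∀ f, M < m f) → ∃ (z shift : Literature.MathematicalPhysics.QuantumFieldTheory.QCDField Nf → ℕ → ℝ) (T : Literature.MathematicalPhysics.QuantumFieldTheory.OSData (Literature.MathematicalPhysics.QuantumFieldTheory.QCDField Nf) 4), Literature.MathematicalPhysics.QuantumFieldTheory.IsQCDAlong (reg.scheme m z shift) T ∧ T.IsNontrivial Literature.MathematicalPhysics.QuantumFieldTheory.QCDField.glue ∧ T.IsNonGaussian Literature.MathematicalPhysics.QuantumFieldTheory.QCDField.glue ∧ (∀ f g : Fin Nf, f ≠ g → T.IsNontrivial (Literature.MathematicalPhysics.QuantumFieldTheory.QCDField.pseudoRe f g)) ∧ ∃ Δ > 0,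 T.HasMassGap Δ ∧ (reg.scheme m z shift).HasLatticeMassGap Δ) → ∃ m₀ : Fin Nf → ℝ, ∀ Δ : ℝ, 0 < Δ → ¬ (reg.scheme m₀ 0 0).HasLatticeMassGap Δ

/-- item stmt-QuantumFields-17394 · support · rank 6 · open · by planner
why it might fail: Contains light-quark lattice QCD: m_crit(k) tuned to κ_c(β_k) beyond the O(aΛ) ambiguity, UV/IR control for arbitrarily light Wilson quarks (near-zero modes of D_W, Aoki/first-order dichotomy), and gaplessness of massless N_f=2,3 QCD (Goldstone/anomaly) — none has an OS-level proof.
sources: GellmannOakesRenner1968, GasserLeutwyler1984, tHooft1980Naturalness, SharpeSingleton1998, Aoki1984WilsonPhase, EdwardsHellerNarayanan1998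
[crux] the CHIRAL COMPLETION — exactly what the statement re-type p117723 added to the parent bridge
(and the intended SHARED chiral item of the heavy-threshold family; same text re-askable by
HeavyThresholdYMBridge / HeatSlicedQuarks / NestedDissectionSea …): for N_f ∈ {2,3}, FROM the
threshold form (some M₀ ≥ 0 and a mass-scaling reg₀ with honest data + gap at all tuples above M₀)
CONCLUDE the re-typed QCDOf N_f — ONE mass-scaling regularisation reg whose m_crit(k) is pinned to
the chiral critical line κ_c(β_k) of Wilson fermions (no hidden offset), carrying species
renormalisations, OS data with IsQCDAlong, non-trivial non-Gaussian glue, dynamical quarks and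
T.HasMassGap Δ ∧ HasLatticeMassGap Δ at EVERY positive tuple (arbitrarily light quarks), AND
reg.IsChiralAtZero: for every ε > 0 some positive tuple has no uniform lattice gap ε — the gap
closes as m → 0⁺ (Goldstone pions m_π² ≍ B·m if chiral symmetry breaks, 't Hooft anomaly matching
otherwise). Consumption lemma landed: Cruxes.StableActionBridge.Sketch.isChiralAtZero_of_goldstone
(a connected two-point LOWER bound ≥ c·e^{−μ a_k n_k}, μ < ε, along a_k n_k → ∞ refutes
HasLatticeMassGap ε); obstruction landed: Theorems.Robust -/
@[route_item "route-QuantumFields-QuarksAsStableAction", crux]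
def ChiralCompletion : Prop :=
  ∀ Nf : ℕ, Nf = 2 ∨ Nf = 3 → (∃ M₀ : ℝ, 0 ≤ M₀ ∧ ∃ reg : Literature.MathematicalPhysics.QuantumFieldTheory.QCDRegularisation Nf, reg.HasMassScaling ∧ ∀ m : Fin Nf → ℝ, (∀ f, M₀ < m f) → ∃ (z shift : Literature.MathematicalPhysics.QuantumFieldTheory.QCDField Nf → ℕ → ℝ) (T : Literature.MathematicalPhysics.QuantumFieldTheory.OSData (Literature.MathematicalPhysics.QuantumFieldTheory.QCDField Nf) 4), Literature.MathematicalPhysics.QuantumFieldTheory.IsQCDAlong (reg.scheme m z shift) T ∧ T.IsNontrivial Literature.MathematicalPhysics.QuantumFieldTheory.QCDField.glue ∧ T.IsNonGaussian Literature.MathematicalPhysics.QuantumFieldTheory.QCDField.glue ∧ (∀ f g : Fin Nf, f ≠ g → T.IsNontrivial (Literature.MathematicalPhysics.QuantumFieldTheory.QCDField.pseudoRe f g)) ∧ ∃ Δ > 0, T.HasMassGap Δ ∧ (reg.scheme m z shift).HasLatticeMassGap Δ) → _root_.QCDOf Nf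

/-- item stmt-QuantumFields-17395 · support · rank 9 · closed · proved by Summit.QuantumFields.QCD.Theorems.stableActionBridgeOfSplit_proof @ 1ed506a48c3d (prover) · by planner
sources: JaffeWitten2000
[support] glue of the bridge's two-regime decomposition after the re-type p117723: ThresholdQCD
(pre-re-type threshold content, shared stmt-QuantumFields-8794) → ChiralCompletion (the re-type
delta) → StableActionBridge. Pure logic, A and S unused: `fun hT hC _ _ => ⟨hC 2 (Or.inl rfl) (hT 2
(Or.inl rfl)), hC 3 (Or.inr rfl) (hT 3 (Or.inr rfl))⟩` (planner Sketch.lean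
`stableActionBridge_of_split`, rc 0, axioms propext/Classical.choice/Quot.sound). Item-level form of
the lead's re-cut skeleton Cruxes/StableActionBridge/Lines/Sketch.lean (stub_formatAP ⊢ threshold
form, stub_chiralCompletion ⊢ delta); filed as items rather than `--split` children because the gate
reserves --split for a seat's final cycle. [deps: ThresholdQCD, ChiralCompletion] [difficulty:
provable-now] -/
@[route_item "route-QuantumFields-QuarksAsStableAction"]
def StableActionBridgeOfSplit : Prop :=
  ThresholdQCD → ChiralCompletion → StableActionBridge

/-- item stmt-QuantumFields-18329 · support · rank 9 · open · by planner
sources: JaffeWitten2000, MontvayMunster1994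
[support] glue of the strategist's decomposition of the crux StableActionBridge
(stmt-QuantumFields-9737) into three STATEMENT-SHAPED pieces — ThresholdQCD (item 8794, threshold
regime), MassContinuation (massive phase open below a uniformly gapped threshold),
ChiralTupleGapless (gapless chiral tuple) — replacing the modus-ponens seam ThresholdQCD →
ChiralCompletion → StableActionBridge (EXEMPT-46 verdict TRIVIAL-SEAM). NOT pure logic: the proof is
the least-admissible-threshold argument — for the regularisation of ThresholdQCD let S = {M : ℝ |
QCDOf-body at every tuple with all components > M}; ChiralTupleGapless bounds S below (a threshold
below the least component of the gapless tuple would gap it), M⋆ = sInf S is admissible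
(least-component argument over Fin N_f, exists_lt_of_csInf_lt), the lattice gap CLOSES above M⋆
(else MassContinuation yields M⋆ − δ ∈ S, contradicting csInf_le), and re-centring m_crit(k) ↦
m_crit(k) + a_k M⋆/Z_m(k) (changes neither HasMassScaling nor the scheme at shifted masses) gives
the re-typed QCDOf N_f INCLUDING IsChiralAtZero, N_f = 2, 3, hence QCD and the bridge (A, S unused).
KERNEL-CHECKED already: Cruxes/StableActionBridge/Lines/least_threshold. -/
@[route_item "route-QuantumFields-QuarksAsStableAction"]
def StableActionBridgeOfPieces : Prop :=
  ThresholdQCD → MassContinuation → ChiralTupleGapless → StableActionBridge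

/-- item stmt-QuantumFields-9738 · support · rank 9 · open · by planner
sources: MontvayMunster1994, HasenfratzDegrand1994, Rothe2005
[support] [first rung of the rank-2 crux; provable now] there are m₀ > 0, c₁ > 0, C such that for
every L ≥ 2, every bare mass m ≥ m₀ (κ = 1/(2m+8) ≤ κ₀) and every SU(3) gauge field U: |det
D_AP[U,m]| ≤ exp(C·L⁴·(8κ)^L − c₁ κ⁴ S_W(U))·|det D_AP[𝟙,m]| (full Wilson action, no bad-plaquette
allowance; the slack C L⁴ (8κ)^L pays for loops winding around the torus). Proof sketch: ‖κH[U]‖ ≤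
8κ < 1 for every U, so log det(1 − κH) = −Σ κⁿ Tr Hⁿ/n converges; closed paths C contribute 2
tr(Γ_C)(Re tr U_C − 3) with tr Γ_C real, the plaquette term has tr Γ = −8 (exact positive κ⁴
coefficient), orders ≥ 6 are bounded by |area|·Σ_{p}(3 − Re tr U_p) and summed geometrically.
[difficulty: provable-now] -/
@[route_item "route-QuantumFields-QuarksAsStableAction"]
def SmallHoppingDiamagnetism : Prop :=
  ∃ m₀ c₁ C : ℝ, 0 < m₀ ∧ 0 < c₁ ∧ ∀ (L : ℕ) [NeZero L], 2 ≤ L → let apDet : Literature.MathematicalPhysics.QuantumFieldTheory.GaugeConfig 4 L (Matrix.specialUnitaryGroup (Fin 3) ℂ) → ℝ → ℂ := fun U m => Literature.MathematicalPhysics.QuantumLattice.fermionDet (Literature.MathematicalPhysics.QuantumLattice.wilsonDirac (Literature.MathematicalPhysics.QuantumLattice.unitaryFundamentalRep (Fin 3) ℂ) (fun e => if e.1 e.2 = -1 then -(⟨(U e).1, Matrix.specialUnitaryGroup_le_unitaryGroup (U e).2⟩ : Matrix.unitaryGroup (Fin 3) ℂ) else ⟨(U e).1, Matrix.specialUnitaryGroup_le_unitaryGroup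 (U e).2⟩) m 1); ∀ m : ℝ, m₀ ≤ m → ∀ U : Literature.MathematicalPhysics.QuantumFieldTheory.GaugeConfig 4 L (Matrix.specialUnitaryGroup (Fin 3) ℂ), ‖apDet U m‖ ≤ Real.exp (C * (L : ℝ) ^ 4 * (4 / (m + 4)) ^ L - c₁ * ((2 * m + 8)⁻¹) ^ 4 * Literature.MathematicalPhysics.QuantumFieldTheory.wilsonAction (Literature.MathematicalPhysics.QuantumLattice.fundamentalRep (Fin 3)) U) * ‖apDet 1 m‖

/-- item stmt-QuantumFields-9739 · support · rank 9 · closed · proved by Summit.QuantumFields.QCD.Theorems.diamagnetismImpliesStability_proof (prover) · by planner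
sources: KennedyLieb1986
[support] CriticalLineDiamagnetism → WilsonQuarkStability (take c₂ = −c₁; pure logic, proved in
Sketch.lean `diamagnetismImpliesStability_holds`, rc 0). [difficulty: provable-now] -/
@[route_item "route-QuantumFields-QuarksAsStableAction"]
def DiamagnetismImpliesStability : Prop :=
  CriticalLineDiamagnetism → WilsonQuarkStability

/-- item stmt-QuantumFields-9740 · support · rank 9 · closed · proved by Summit.QuantumFields.QCD.Theorems.marginalSiteRP_proof @ 7b81f61aeb53 (prover) · by planner
sources: Luscher1977, OsterwalderSeilerAnnPhys1978, MontvayMunster1994, KennedyLieb1986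
[support] [card P1 lemma; provable now] for every N_f, every even L ≥ 4, every real β and bare
masses m_f > −1 (κ_f < 1/6): the signed unquenched gauge functional F ↦ ∫ F(U) ∏_f det D_AP[U,m_f]
dμ_W,β(U) is reflection positive for the SITE reflection Θ₀U = (τ_{e₀}U).timeReflect in the lattice
hyperplanes t = 0, L/2 (as in `TorusSiteRP`): for bounded measurable F depending only on links with
both endpoints in 0 ≤ t ≤ L/2, ∫ conj(F(Θ₀U))·F(U)·∏det dμ_W has non-negative real part and zero
imaginary part. It is the restriction of Lüscher/Osterwalder–Seiler joint (U, ψ, ψ̄) site-RP (r = 1,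
|K| < 1/6, antiperiodic = trace) to Grassmann-free F; the other three axes follow by symmetry.
[difficulty: provable-now] -/
@[route_item "route-QuantumFields-QuarksAsStableAction"]
def MarginalSiteRP : Prop :=
  ∀ (Nf L : ℕ) [NeZero L], Even L → 4 ≤ L → ∀ (β : ℝ) (m : Fin Nf → ℝ), (∀ f, -1 < m f) → let apDet : Literature.MathematicalPhysics.QuantumFieldTheory.GaugeConfig 4 L (Matrix.specialUnitaryGroup (Fin 3) ℂ) → ℝ → ℂ := fun U m => Literature.MathematicalPhysics.QuantumLattice.fermionDet (Literature.MathematicalPhysics.QuantumLattice.wilsonDirac (Literature.MathematicalPhysics.QuantumLattice.unitaryFundamentalRep (Fin 3) ℂ) (fun e => if e.1 e.2 = -1 then -(⟨(U e).1, Matrix.specialUnitaryGroup_le_unitaryGroup (U e).2⟩ : Matrix.unitaryGroup (Fin 3) ℂ) else ⟨(U e).1, Matrix.specialUnitaryGroup_le_unitaryGroup (U e).2⟩) m 1); ∀ F : Literature.MathematicalPhysics.QuantumFieldTheory.GaugeConfig 4 L (Matrix.specialUnitaryGroup (Fin 3) ℂ) → ℂ, Measurable F → (∃ B : ℝ, ∀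 U, ‖F U‖ ≤ B) → (∀ U V : Literature.MathematicalPhysics.QuantumFieldTheory.GaugeConfig 4 L (Matrix.specialUnitaryGroup (Fin 3) ℂ), (∀ e : Literature.MathematicalPhysics.QuantumFieldTheory.Edge 4 L, (e.1 0).val + (if e.2 = 0 then 1 else 0) ≤ L / 2 → U e = V e) → F U = F V) → 0 ≤ (∫ U, (starRingEnd ℂ) (F ((Literature.MathematicalPhysics.QuantumFieldTheory.GaugeConfig.timeReflect (fun e => U (e.1 - Pi.single (0 : Fin 4) (1 : ZMod L), e.2))))) * F U * (∏ f, apDet U (m f)) ∂(Literature.MathematicalPhysics.QuantumFieldTheory.wilsonMeasure (d := 4) (L := L) (Literature.MathematicalPhysics.QuantumLattice.fundamentalRep (Fin 3)) β)).re ∧ (∫ U, (starRingEnd ℂ) (F ((Literature.MathematicalPhysics.QuantumFieldTheory.GaugeConfig.timeReflect (fun e => U (e.1 - Pi.single (0 : Fin 4) (1 : ZMod L), e.2))))) * F U * (∏ f, apDet U (m f)) ∂(Literature.MathematicalPhysics.QuantumFieldTheory.wilsonMeasure (d := 4) (L := L) (Literature.MathematicalPhysics.QuantumLattice.fundamentalRep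 (Fin 3)) β)).im = 0

-- earlier Assembly (stmt-QuantumFields-9741, replaced 2026-08-16T15:37:48Z -> stmt-QuantumFields-15410): proved by Summit.QuantumFields.QCD.Theorems.quarksAsStableActionAssembly_proof — UnquenchedChessboardBound → WilsonQuarkStability → StableActionBridge → _root_.QCD
/-- item stmt-QuantumFields-15410 · assembly · rank 1 · closed · proved by Summit.QuantumFields.QCD.Theorems.quarksAsStableActionAssembly_proof @ 73a2b9add1c5 (prover) · by planner
sources: JaffeWitten2000, KennedyLieb1986
[assembly] SHARP closing path of the route: CriticalLineDiamagnetism → UnquenchedChessboardBound →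
StableActionBridge → QCD (cruxes #2, #3, #5 ⊢ QCD). With the chessboard bound A and the bridge B (:=
A → S → QCD by definition), the sharp diamagnetic bound closes QCD because it implies the stability
bound S (support DiamagnetismImpliesStability, c₂ := −c₁, landed as
Theorems.diamagnetismImpliesStability_proof). One-line proof: `fun hC hA hB => hB hA
(Summit.QuantumFields.QCD.Theorems.diamagnetismImpliesStability_proof hC)` (planner Sketch.lean
`assemblyR_holds`, rc 0, axioms propext/Classical.choice/Quot.sound). The WEAK path A → S → B → QCD
is the deciding theorem `closes` (unchanged); it was this item's rev-0 text and is a propositional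
tautology (ground battery `ground.trivial`, 2026-08-16), hence this restatement. [difficulty:
provable-now] -/
@[route_item "route-QuantumFields-QuarksAsStableAction"]
def Assembly : Prop :=
  CriticalLineDiamagnetism → UnquenchedChessboardBound → StableActionBridge → _root_.QCD

/-! D-0027 §2.1 — DECIDING THEOREM (planner-authored via `route open/edit --closes-file`; by planner-rrepair-QuantumFields-QuarksAsStableAc-0d71b161-0 2026-08-16T23:20:40Z):
its hypotheses are this route's items and its conclusion the sub-problem Statement (glue_lint), and it elaborates with this file. -/

/-- D-0027 §2.1 deciding theorem of route QuarksAsStableAction: the bridge crux is by definition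
`UnquenchedChessboardBound → WilsonQuarkStability → QCD`, so the three listed items give the conjunct
`QCD := QCDOf 2 ∧ QCDOf 3` by modus ponens (planner's Sketch.lean `assembly_holds`, rc 0). Statement
re-type p117723 (2026-08-16): `QCDOf` conjoins `reg.IsChiralAtZero`; the bridge names `_root_.QCD` and
therefore carries the new conjunct, which the route supplies through the bridge's glued split
`ThresholdQCD → ChiralCompletion → StableActionBridge` (ThresholdQCD = the pre-re-type threshold content,
shared with HeavyThresholdYMBridge stmt-QuantumFields-8794; ChiralCompletion = the re-type delta: pinned
`m_crit`, light-quark body, gap closure). Re-elaborated against the re-typed conjunct (route-repair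
0d71b161, Sketch.lean `closes'`, rc 0, axioms propext / Classical.choice / Quot.sound). -/
@[closes "route-QuantumFields-QuarksAsStableAction"] theorem closes : UnquenchedChessboardBound → WilsonQuarkStability → StableActionBridge → _root_.QCD :=
  fun hA hS hB => hB hA hS

end Summit.QuantumFields.QCD.Theses.QuarksAsStableAction
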